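import Summits.QuantumFields.YangMills.Theorems.FluctuationComparisonRegPrIntLS2BetaDistributedHolonomySU2
import Summits.QuantumFields.YangMills.Theorems.FluctuationComparisonRegPrIntLS2BetaWhitneyHatLiftRelative
import Mathlib.Analysis.Convex.SpecificFunctions.Deriv
import Mathlib.Analysis.SpecialFunctions.Trigonometric.Bounds
import HarnessLib

/-!
# S2β · D-GUARD ∕ (BG∞) — THE EXPONENTIAL CHART OF `SU(2)` IS 1-LIPSCHITZ, AND ITS INVERSE IS `((π − r)∕sin r)`-LIPSCHITZ OFF THE ANTIPODAL CAP:
# the CONE LEMMA of UV3-NODE §116.3 (fillings T and S of the 8-colour gluing), i.e. the beyond-hemisphere twin of ✓`…DistributedHolonomySU2.dist1_expPoint_smul_mul_inv_le`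

Cell `ym3-torus` (YM ladder rung R3 = continuum `SU(2)` Yang–Mills on the three-torus at fixed lattice data — a RUNG: NOT d = 4, NOT infinite volume,
NOT a mass gap, NOT Clay).  Width seat «width 19» `ym3-torus-px19` (gen 25, ★p1 lineage), FREE px helper on crux `stmt-QuantumFields-20520`
(`FluctuationComparisonRegPrIntL`; registry `Lines/semiclassical_s2beta.lean` UNTOUCHED, 0∕5); `--kind proof --supports stmt-QuantumFields-20520 --as helper`,
count-neutral, DEFINITION-FREE (0 `def`, 0 `instance`, 0 `notation`, 0 `sorry`, default heartbeats).  NAMED by the architect-lineage ruling «(BG∞) PLAN OF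
RECORD = UV3-NODE §116» (px17 g23, STATUS 2026-09-01T00:13:02Z: «px19 g25 ← (G2) + (G5), GO»).

WHY.  The (BG∞) construction (UV3-NODE §116.3) glues local small-bond gauges on blocks of side `ρ ≍ θ^{−1∕2}` by Lipschitz sections of their site cocycle;
the sections are built by three FILLING stages (interval ∕ tube ∕ sphere), and the tube and sphere fillings are CONINGS: a discrete loop or sphere
`q : sites → SU(2)` that misses a cap `B(p, r)` is contracted geodesically toward `−p`.  What the step bounds of §116.3 need is exactly: in the exponential
chart at the cone centre, (G5a) scaling by `s ∈ [0, 1]` costs at most the factor `s` in the CHART distance, and (G5b) off the antipodal cap of radius `r` the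
chart distance is at most `Λ(r) := (π − r)∕sin r` times the group distance — so the cone at parameter `s` is `s·Λ(r)`-Lipschitz in `dist1`.  The tree has the
HEMISPHERE case with the sharp factor `1` (✓`dist1_expPoint_smul_mul_inv_le`, `‖x‖, ‖y‖ ≤ π∕2`); this file trades sharpness for the whole closed off-cap
region `‖x‖, ‖y‖ ≤ π − r` (`0 < r < π`), which is where the fillings live (their data are `O(1)`-spread loops and spheres, not hemispherical).

THE TWO INEQUALITIES (`a = ‖x‖`, `b = ‖y‖`, `D = ⟪x, y⟫ ∈ [−ab, ab]`; spherical law of cosines ✓`inner_exp_imQuat`: `|e^x − e^y|² = 2 − 2(cos a cos b +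
sinc a sinc b·D)`, while `|x − y|² = a² + b² − 2D`).  Both differences are AFFINE in `D`.  (G5a) `|e^x − e^y|² ≤ |x − y|²`: the `D`-slope `2(sinc a sinc b − 1)`
is `≤ 0`, so the worst case is `D = ab`, where it reads `2 − 2cos(a − b) ≤ (a − b)²` (Mathlib `one_sub_sq_div_two_le_cos`).  (G5b) `|x − y|² ≤ Λ²|e^x − e^y|²`:
affine in `D`, so it suffices at `D = ±ab`, where it reads `(a ∓ b)² ≤ Λ²(2 − 2cos(a ∓ b)) = 4Λ² sin²((a ∓ b)∕2)`, i.e. `w ≤ Λ sin w` for `w = |a − b|∕2,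
(a + b)∕2 ∈ [0, π − r]` — the chord-slope monotonicity of the CONCAVE function `sin` on `[0, π]` (Mathlib `strictConcaveOn_sin_Icc`): `w·sin r = w·sin(π − r) ≤
(π − r)·sin w`.  No proximity hypothesis is needed: the log chart is GLOBALLY `Λ(r)`-Lipschitz on the closed off-cap region for the chordal metric (sharp at the
antipodal pair `x = −y`, `‖x‖ = π − r`).

WHAT IS PROVED (sorry-free; `E := EuclideanSpace ℝ (Fin 3)`).
* §1 `mul_sin_le_mul_sin` (`0 ≤ w ≤ v ≤ π`, `0 < v` ⇒ `w·sin v ≤ v·sin w`), `sq_le_mul_two_sub_two_cos` (`0 ≤ w ≤ π − r` ⇒ `(2w)² ≤ Λ(r)²·(2 − 2cos(2w))`).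
* §2 (G5a) `‖exp ιx − exp ιy‖ ≤ ‖x − y‖` for ALL `x, y` is ON THE TREE (✓`…WhitneyHatLiftRelative.norm_exp_imQuat_sub_exp_imQuat_le_norm_sub`, px12 g23; reused,
  not restated); ★★ `norm_sub_le_mul_norm_exp_imQuat_sub` — (G5b) `0 < r < π`, `‖x‖, ‖y‖ ≤ π − r` ⇒ `‖x − y‖ ≤ Λ(r)·‖exp ιx − exp ιy‖`.
* §3 (in `SU(2)`, `dist1` currency; ✓`SU2NearCommuting.dist1_mul_inv_eq_norm_sub` and ✓`…WhitneyHatLiftRelative.dist1_expPoint_mul_inv_expPoint_le` reused)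
  ★ `dist1_expPoint_smul_mul_inv_smul_le` (RADIAL step: `dist1 (exp(sx)·exp(s′x)⁻¹) ≤ |s − s′|·‖x‖`), ★★ `norm_sub_le_mul_dist1_expPoint`,
  ★★★ `dist1_expPoint_smul_mul_inv_le_offCap` — THE CONE LEMMA at centre `1`: `‖x‖, ‖y‖ ≤ π − r`, `0 ≤ s` ⇒
  `dist1 (expPoint (s•x)·(expPoint (s•y))⁻¹) ≤ s·Λ(r)·dist1 (expPoint x·(expPoint y)⁻¹)`;
  ★★★ `dist1_cone_mul_inv_cone_le` — the same at any centre `c`, written out: with `q̂ := logVec (su2Quat (c⁻¹ q))`,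
  `dist1 ((c·expPoint (s•q̂))·(c·expPoint (s•q̂′))⁻¹) ≤ s·Λ(r)·dist1 (q·q′⁻¹)` whenever `‖q̂‖, ‖q̂′‖ ≤ π − r` (✓`expPoint_logVec`, ✓`dist1_conj`).

HONEST SCOPE.  Spherical trigonometry of `S³ = SU(2)`; no lattice, no field, no gauge construction; constants sharp in `r` but the fillings of §116.3 use them
crudely; nothing of Bałaban's renormalisation-group analysis is asserted or proved ([Balaban1985RegularSpaces] (1.29) p.81, (1.36) p.82, Thm 2 p.83 — the
small, distributed gauges this serves; print gauge-fixes CUBES, never the torus).  (BG∞) ∕ `hsupp⁺` is a CONJECTURE (LEAD §114.3; FL-39 j345235 alive) and is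
NOT proved here; GAP♯∘ (`stub_uniformFibreGapOrbit`, registry UNTOUCHED), the five registered stubs (0∕5), S2β, crux 20520, 19936, 19200, `YM3TorusSU2` are
NOT proved; no registered stub is closed; rung R3 — NOT d = 4, NOT infinite volume, NOT a mass gap, NOT Clay; the Yang–Mills mass gap is NOT proved.
Axioms standard.

References: T. Bałaban, CMP **99** (1985) 75–102 [Balaban1985RegularSpaces] ((1.29) p.81, (1.36) p.82, Thm 2 p.83); K. Uhlenbeck, CMP **83** (1982) 31–42
[Uhlenbeck1982]; I. Chevyrev, CMP **372** (2019) 1027–1058, Lemma 4.14 (the quantitative null-homotopy this cone replaces in our discrete fillings).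
-/

set_option autoImplicit false

noncomputable section

namespace Summit.QuantumFields.YangMills.Theorems.FluctuationComparisonRegPrIntLS2BetaExpChartLipschitzOffCap

open NormedSpace
open scoped Real Quaternion RealInnerProductSpace
open Literature.MathematicalPhysics.QuantumLattice (su2Quat norm_su2Quat)
open Literature.MathematicalPhysics.QuantumFieldTheory.Balaban1983to89
open T4CubeChartGnomonic (SU2)
open T4HaarSU2ExpChart (imQuat norm_imQuat exp_imQuat norm_exp_imQuat expPoint su2Quat_expPoint)
open T4HaarSU2Translate (su2Quat_mul su2Quat_one)
open T4ExpWindowSmallField (logVec norm_logVec_le_pi expPoint_logVec dist1_eq_norm_su2Quat_sub_one)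
open Summit.QuantumFields.YangMills.Theorems.FluctuationComparisonRegPrIntLS2BetaDistributedHolonomySU2 (inner_exp_imQuat norm_exp_imQuat_sub_sq)
open Summit.QuantumFields.YangMills.Theorems.FluctuationComparisonRegPrIntLS2BetaWhitneyHatLiftRelative (norm_exp_imQuat_sub_exp_imQuat_le_norm_sub dist1_expPoint_mul_inv_expPoint_le)
open Summit.QuantumFields.YangMills.Theorems.SU2NearCommuting (dist1_mul_inv_eq_norm_sub)

/-! ## §1 Two scalar inequalities: the chord slopes of the concave `sin`, and `w ≤ Λ(r)·sin w` off the cap -/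

/-- **Chord slopes of `sin` from `0` decrease on `[0, π]`**: `0 ≤ w ≤ v ≤ π`, `0 < v` ⇒ `w·sin v ≤ v·sin w` (concavity of `sin` on `[0, π]` between the points
`0` and `v`). [folklore] -/
theorem mul_sin_le_mul_sin {w v : ℝ} (hw0 : 0 ≤ w) (hwv : w ≤ v) (hv : 0 < v) (hvπ : v ≤ π) : w * Real.sin v ≤ v * Real.sin w := by
  have hb0 : 0 ≤ w / v := div_nonneg hw0 hv.le
  have hb1 : w / v ≤ 1 := (div_le_one hv).2 hwv
  have hconc := strictConcaveOn_sin_Icc.concaveOn.2 (⟨le_rfl, Real.pi_pos.le⟩ : (0 : ℝ) ∈ Set.Icc 0 π) (⟨hv.le, hvπ⟩ : v ∈ Set.Icc 0 π)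
    (sub_nonneg.2 hb1) hb0 (by ring)
  simp only [smul_eq_mul, Real.sin_zero, mul_zero, zero_add] at hconc
  have hbv : w / v * v = w := div_mul_cancel₀ w hv.ne'
  rw [hbv] at hconc
  -- `(w∕v)·sin v ≤ sin w`, multiply by `v > 0`
  have := mul_le_mul_of_nonneg_left hconc hv.le
  calc w * Real.sin v = v * (w / v * Real.sin v) := by rw [← mul_assoc, mul_div_cancel₀ w hv.ne']
    _ ≤ v * Real.sin w := this

/-- **`w ≤ Λ(r)·sin w` on `[0, π − r]`, squared and doubled**: for `0 < r < π` and `0 ≤ w ≤ π − r`,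
`(2w)² ≤ ((π − r)∕sin r)²·(2 − 2cos(2w))` (note `2 − 2cos(2w) = 4 sin² w` and `sin(π − r) = sin r`). [folklore] -/
theorem sq_le_mul_two_sub_two_cos {r w : ℝ} (hr : 0 < r) (hrπ : r < π) (hw0 : 0 ≤ w) (hw : w ≤ π - r) :
    (2 * w) ^ 2 ≤ ((π - r) / Real.sin r) ^ 2 * (2 - 2 * Real.cos (2 * w)) := by
  have hsr : 0 < Real.sin r := Real.sin_pos_of_pos_of_lt_pi hr hrπ
  have hv : 0 < π - r := sub_pos.2 hrπ
  -- `w·sin r ≤ (π − r)·sin w`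
  have h1 : w * Real.sin r ≤ (π - r) * Real.sin w := by
    have := mul_sin_le_mul_sin hw0 hw hv (by linarith)
    rwa [Real.sin_pi_sub] at this
  have hsw : 0 ≤ Real.sin w := Real.sin_nonneg_of_nonneg_of_le_pi hw0 (by linarith)
  -- `w ≤ Λ·sin w`
  have h2 : w ≤ (π - r) / Real.sin r * Real.sin w := by
    rw [div_mul_eq_mul_div, le_div_iff₀ hsr]
    linarith
  have hΛ : 0 ≤ (π - r) / Real.sin r := div_nonneg hv.le hsr.le
  have h3 : w ^ 2 ≤ ((π - r) / Real.sin r * Real.sin w) ^ 2 := pow_le_pow_left₀ hw0 h2 2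
  have hcos : Real.cos (2 * w) = 1 - 2 * Real.sin w ^ 2 := Real.cos_two_mul' w ▸ by rw [Real.cos_sq']; ring
  rw [hcos]
  nlinarith [h3]

/-! ## §2 The two chart inequalities in the unit quaternions -/

/-- `sinc a·a = sin a`. [folklore] -/
private theorem sinc_mul_self (x : ℝ) : Real.sinc x * x = Real.sin x := by
  by_cases hx : x = 0
  · simp [hx]
  · rw [Real.sinc_of_ne_zero hx, div_mul_cancel₀ _ hx]

/-- ★★ **THE LOG CHART IS `Λ(r)`-LIPSCHITZ OFF THE ANTIPODAL CAP** (G5b): for `0 < r < π` and `‖x‖, ‖y‖ ≤ π − r`,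
`‖x − y‖ ≤ ((π − r)∕sin r)·‖exp ιx − exp ιy‖` — globally on the closed off-cap region, no proximity hypothesis (affine in `⟪x,y⟫`, so it suffices at the
parallel and antiparallel configurations, where it is `w ≤ Λ sin w` on `[0, π − r]`). [cite: Balaban1985RegularSpaces, (1.36) p.82] -/
theorem norm_sub_le_mul_norm_exp_imQuat_sub {r : ℝ} (hr : 0 < r) (hrπ : r < π) (x y : EuclideanSpace ℝ (Fin 3))
    (hx : ‖x‖ ≤ π - r) (hy : ‖y‖ ≤ π - r) :
    ‖x - y‖ ≤ (π - r) / Real.sin r * ‖exp (imQuat x) - exp (imQuat y)‖ := by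
  letI : NormedAlgebra ℚ ℍ := NormedAlgebra.restrictScalars ℚ ℝ ℍ
  have hsr : 0 < Real.sin r := Real.sin_pos_of_pos_of_lt_pi hr hrπ
  have hΛ : 0 ≤ (π - r) / Real.sin r := div_nonneg (sub_pos.2 hrπ).le hsr.le
  set Λ := (π - r) / Real.sin r with hΛdef
  have hsq : ‖x - y‖ ^ 2 ≤ (Λ * ‖exp (imQuat x) - exp (imQuat y)‖) ^ 2 := by
    rw [mul_pow, norm_exp_imQuat_sub_sq, inner_exp_imQuat, @norm_sub_sq_real (EuclideanSpace ℝ (Fin 3))]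
    set a := ‖x‖ with ha
    set b := ‖y‖ with hb
    set D := inner ℝ x y with hD
    have ha0 : 0 ≤ a := norm_nonneg x
    have hb0 : 0 ≤ b := norm_nonneg y
    have hDabs : |D| ≤ a * b := abs_real_inner_le_norm x y
    have hD1 := (abs_le.1 hDabs).1
    have hD2 := (abs_le.1 hDabs).2
    have hsa : Real.sinc a * a = Real.sin a := sinc_mul_self a
    have hsb : Real.sinc b * b = Real.sin b := sinc_mul_self b
    -- endpoint `D = ab`: `(a − b)² ≤ Λ²(2 − 2cos(a − b))`
    have hP : (a - b) ^ 2 ≤ Λ ^ 2 * (2 - 2 * (Real.cos a * Real.cos b + Real.sinc a * Real.sinc b * (a * b))) := by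
      have e1 : Real.sinc a * Real.sinc b * (a * b) = Real.sin a * Real.sin b := by rw [← hsa, ← hsb]; ring
      rw [e1, ← Real.cos_sub]
      -- `cos(a − b) = cos(2w)`, `w = |a − b|∕2 ≤ π − r`
      have hw0 : 0 ≤ |a - b| / 2 := by positivity
      have hw : |a - b| / 2 ≤ π - r := by
        have : |a - b| ≤ π - r := by rw [abs_le]; constructor <;> linarith
        linarith [abs_nonneg (a - b)]
      have h := sq_le_mul_two_sub_two_cos hr hrπ hw0 hw
      rw [show 2 * (|a - b| / 2) = |a - b| by ring, sq_abs, Real.cos_abs] at h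
      exact h
    -- endpoint `D = −ab`: `(a + b)² ≤ Λ²(2 − 2cos(a + b))`
    have hM : (a + b) ^ 2 ≤ Λ ^ 2 * (2 - 2 * (Real.cos a * Real.cos b + Real.sinc a * Real.sinc b * (-(a * b)))) := by
      have e1 : Real.sinc a * Real.sinc b * (-(a * b)) = -(Real.sin a * Real.sin b) := by rw [← hsa, ← hsb]; ring
      rw [e1, show Real.cos a * Real.cos b + -(Real.sin a * Real.sin b) = Real.cos (a + b) by rw [Real.cos_add]; ring]
      have hw0 : 0 ≤ (a + b) / 2 := by positivity
      have hw : (a + b) / 2 ≤ π - r := by linarith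
      have h := sq_le_mul_two_sub_two_cos hr hrπ hw0 hw
      rw [show 2 * ((a + b) / 2) = a + b by ring] at h
      exact h
    -- affine in `D`: `2ab·g(D) = (ab + D)·g(ab) + (ab − D)·g(−ab)`
    rcases eq_or_lt_of_le (mul_nonneg ha0 hb0) with hab | hab
    · -- `ab = 0`: then `D = 0`, and `a = 0` or `b = 0`
      have hD0 : D = 0 := by rw [← hab] at hDabs; exact abs_nonpos_iff.1 hDabs
      rw [hD0]
      rcases mul_eq_zero.1 hab.symm with ha' | hb'
      · rw [ha'] at hP ⊢
        simp only [zero_sub, even_two, Even.neg_pow, Real.cos_zero, one_mul, zero_mul, mul_zero, add_zero] at hP ⊢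
        nlinarith [hP]
      · rw [hb'] at hP ⊢
        simp only [sub_zero, Real.cos_zero, mul_one, mul_zero, add_zero] at hP ⊢
        nlinarith [hP]
    · have hsumP : 0 ≤ a * b + D := by linarith
      have hsumM : 0 ≤ a * b - D := by linarith
      nlinarith [mul_nonneg hsumP (sub_nonneg.2 hP), mul_nonneg hsumM (sub_nonneg.2 hM), hab]
  have h := (pow_le_pow_iff_left₀ (norm_nonneg _) (mul_nonneg hΛ (norm_nonneg _)) two_ne_zero).1 hsq
  exact h

/-! ## §3 In `SU(2)`: the cone lemma in `dist1` currency -/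

/-- ★ **THE RADIAL STEP OF A CONE**: `dist1 (expPoint (s•x)·(expPoint (s′•x))⁻¹) ≤ |s − s′|·‖x‖`. [cite: Balaban1985RegularSpaces, (1.36) p.82] -/
theorem dist1_expPoint_smul_mul_inv_smul_le (x : EuclideanSpace ℝ (Fin 3)) (s s' : ℝ) :
    dist1 (expPoint (s • x) * (expPoint (s' • x))⁻¹) ≤ |s - s'| * ‖x‖ := by
  have h := dist1_expPoint_mul_inv_expPoint_le (s • x) (s' • x)
  rwa [← sub_smul, norm_smul, Real.norm_eq_abs] at h

/-- ★★ `‖x − y‖ ≤ Λ(r)·dist1 (expPoint x·(expPoint y)⁻¹)` off the antipodal cap (`0 < r < π`, `‖x‖, ‖y‖ ≤ π − r`). [cite: Balaban1985RegularSpaces, (1.36) p.82] -/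
theorem norm_sub_le_mul_dist1_expPoint {r : ℝ} (hr : 0 < r) (hrπ : r < π) (x y : EuclideanSpace ℝ (Fin 3))
    (hx : ‖x‖ ≤ π - r) (hy : ‖y‖ ≤ π - r) :
    ‖x - y‖ ≤ (π - r) / Real.sin r * dist1 (expPoint x * (expPoint y)⁻¹) := by
  rw [dist1_mul_inv_eq_norm_sub, su2Quat_expPoint, su2Quat_expPoint]
  exact norm_sub_le_mul_norm_exp_imQuat_sub hr hrπ x y hx hy

/-- ★★★ **THE CONE LEMMA AT CENTRE `1`**: for `0 < r < π`, `‖x‖, ‖y‖ ≤ π − r` and `0 ≤ s`,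
`dist1 (expPoint (s•x)·(expPoint (s•y))⁻¹) ≤ s·((π − r)∕sin r)·dist1 (expPoint x·(expPoint y)⁻¹)` — scaling two off-cap points toward `1` by the same factor
`s` is `s·Λ(r)`-Lipschitz (the hemisphere case `r = π∕2` holds with the sharp factor `1`: ✓`dist1_expPoint_smul_mul_inv_le`). [cite: Balaban1985RegularSpaces, (1.36) p.82] -/
theorem dist1_expPoint_smul_mul_inv_le_offCap {r : ℝ} (hr : 0 < r) (hrπ : r < π) (x y : EuclideanSpace ℝ (Fin 3))
    (hx : ‖x‖ ≤ π - r) (hy : ‖y‖ ≤ π - r) {s : ℝ} (hs : 0 ≤ s) :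
    dist1 (expPoint (s • x) * (expPoint (s • y))⁻¹) ≤ s * ((π - r) / Real.sin r) * dist1 (expPoint x * (expPoint y)⁻¹) := by
  have h1 := dist1_expPoint_mul_inv_expPoint_le (s • x) (s • y)
  rw [← smul_sub, norm_smul, Real.norm_eq_abs, abs_of_nonneg hs] at h1
  have h2 := norm_sub_le_mul_dist1_expPoint hr hrπ x y hx hy
  calc dist1 (expPoint (s • x) * (expPoint (s • y))⁻¹) ≤ s * ‖x - y‖ := h1
    _ ≤ s * ((π - r) / Real.sin r * dist1 (expPoint x * (expPoint y)⁻¹)) := mul_le_mul_of_nonneg_left h2 hs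
    _ = s * ((π - r) / Real.sin r) * dist1 (expPoint x * (expPoint y)⁻¹) := by ring

/-- ★★★ **THE CONE LEMMA AT ANY CENTRE `c`** (written out, no `def`): with the chart coordinates `x := logVec (su2Quat (c⁻¹·q))`, `y := logVec (su2Quat (c⁻¹·q′))`
of `q, q′` at `c`, if both avoid the cap antipodal to `c` (`‖x‖, ‖y‖ ≤ π − r`) then the cone points `c·expPoint (s•x)`, `c·expPoint (s•y)` satisfy
`dist1 ((c·expPoint (s•x))·(c·expPoint (s•y))⁻¹) ≤ s·Λ(r)·dist1 (q·q′⁻¹)` (left-invariance ✓`dist1_conj` and ✓`expPoint_logVec`). [cite: Balaban1985RegularSpaces, Thm 2 p.83] -/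
theorem dist1_cone_mul_inv_cone_le {r : ℝ} (hr : 0 < r) (hrπ : r < π) (c q q' : SU2)
    (hx : ‖logVec (su2Quat (c⁻¹ * q))‖ ≤ π - r) (hy : ‖logVec (su2Quat (c⁻¹ * q'))‖ ≤ π - r) {s : ℝ} (hs : 0 ≤ s) :
    dist1 ((c * expPoint (s • logVec (su2Quat (c⁻¹ * q)))) * (c * expPoint (s • logVec (su2Quat (c⁻¹ * q'))))⁻¹) ≤
      s * ((π - r) / Real.sin r) * dist1 (q * q'⁻¹) := by
  set x := logVec (su2Quat (c⁻¹ * q)) with hxdef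
  set y := logVec (su2Quat (c⁻¹ * q')) with hydef
  -- strip the centre: `dist1 (c·E·(c·E′)⁻¹) = dist1 (E·E′⁻¹)`
  have e1 : (c * expPoint (s • x)) * (c * expPoint (s • y))⁻¹ = c * (expPoint (s • x) * (expPoint (s • y))⁻¹) * c⁻¹ := by group
  rw [e1, GaugeGroup.dist1_conj]
  -- the targets: `expPoint x = c⁻¹ q`, `expPoint y = c⁻¹ q′`
  have hq : expPoint x = c⁻¹ * q := expPoint_logVec _
  have hq' : expPoint y = c⁻¹ * q' := expPoint_logVec _
  have e2 : dist1 (expPoint x * (expPoint y)⁻¹) = dist1 (q * q'⁻¹) := by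
    rw [hq, hq', show c⁻¹ * q * (c⁻¹ * q')⁻¹ = c⁻¹ * (q * q'⁻¹) * c⁻¹⁻¹ by group, GaugeGroup.dist1_conj]
  rw [← e2]
  exact dist1_expPoint_smul_mul_inv_le_offCap hr hrπ x y hx hy hs

end Summit.QuantumFields.YangMills.Theorems.FluctuationComparisonRegPrIntLS2BetaExpChartLipschitzOffCap

end
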